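import Summits.ResolutionOfSingularities.ResolutionOfSingularities.Theorems.FrobeniusLadderFInjectiveMacaulayficationFDStorey1PIdeal
import HarnessLib

/-!
# BED D STOREY 1 — THE FEDDER WITNESS AT THE EXCEPTIONAL POINT `P`: the strict transform `g₂₇₇` of chart 277 lies in the Frobenius power `𝔪_P^{[2]} = (Y₀², Y₁², (Y₂+1)², Y₃², Y₄²)`
# (so `P = (0,0,1,0,0)` is NOT an F-pure point of `k[Y]/(g₂₇₇)`: Fedder), explicit polynomial readings of `g₂₆₆`, `g₂₇₇`
# (crux `FInjectiveMacaulayfication` stmt-ResolutionOfSingularities-15315, chain w45a; (W-TD) BED D storey 1 (D-1) «P not F-pure», res-L1-w45a-plan-1 R21.18 (4); seat res-L1-w45a-stub-2 g10)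

Support file for crux stmt-ResolutionOfSingularities-15315 (`FrobeniusLadder.FInjectiveMacaulayfication`), chain w45a.
[OURS · L1 W4.5a] — NOT a statement of any manuscript; AI-written, weaker than expert review.

`evalL_G266` / `evalL_G277` — the strict transforms of the two P-charts of `Bl_{𝔪·K} X_D` as explicit polynomials (`g₂₇₇ = Y₂² + Y₂Y₃Y₄⁴ + 1 + Y₁³ + Y₀³ + Y₂Y₃²Y₄` = res-L1-w45a-tri-2's
storey-2 equation `G` before the translation `Y₂ ↦ Y₂ + 1`); ★ `evalL_G277_mem_frobeniusPower_P` — `g₂₇₇ ∈ (Y₀², Y₁², (Y₂+1)², Y₃², Y₄²)` (characteristic 2: `Y₂² + 1 = (Y₂+1)²`),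
the Fedder witness that the local ring of `k[Y]/(g₂₇₇)` at `𝔪_P` is not F-pure — storey 2 (res-L1-w45a-stub-3's (D-2), the blow-up at `P`) is NEEDED. No definitions, no named facts.
[certificate reading; cite: Fedder1983, Thm. 1.12]
-/

-- single-problem summit: the doubled namespace component is forced
set_option linter.dupNamespace false

noncomputable section

namespace Summit.ResolutionOfSingularities.ResolutionOfSingularities.Theorems.FInjectiveMacaulayfication.FDStorey1PFedder

open MvPolynomial
open Summit.ResolutionOfSingularities.ResolutionOfSingularities.Theorems.FInjectiveMacaulayfication
open FDStorey1Fan FDStorey1PIdeal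

variable (k : Type) [Field k]

/-- The strict transform of chart 266: `g₂₆₆ = 1 + Y₂²Y₃Y₄⁴ + Y₂² + Y₁³Y₂² + Y₀³Y₂² + Y₂³Y₃²Y₄`. [generated-table reading] -/
theorem evalL_G266 : KLocCellKit.evalL k (G (266 : Fin 327)) =
    1 + X 2 ^ 2 * X 3 * X 4 ^ 4 + X 2 ^ 2 + X 1 ^ 3 * X 2 ^ 2 + X 0 ^ 3 * X 2 ^ 2 + X 2 ^ 3 * X 3 ^ 2 * X 4 := by
  rw [show (266 : Fin 327) = ⟨266, by decide⟩ from rfl, G_P.1]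
  simp only [KLocCellKit.evalL, List.map_cons, List.map_nil, List.sum_cons, List.sum_nil, Int.cast_one, PConeFedderData.monomial_five]
  ring

/-- The strict transform of chart 277: `g₂₇₇ = Y₂² + Y₂Y₃Y₄⁴ + 1 + Y₁³ + Y₀³ + Y₂Y₃²Y₄`. [generated-table reading] -/
theorem evalL_G277 : KLocCellKit.evalL k (G (277 : Fin 327)) =
    X 2 ^ 2 + X 2 * X 3 * X 4 ^ 4 + 1 + X 1 ^ 3 + X 0 ^ 3 + X 2 * X 3 ^ 2 * X 4 := by
  rw [show (277 : Fin 327) = ⟨277, by decide⟩ from rfl, G_P.2]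
  simp only [KLocCellKit.evalL, List.map_cons, List.map_nil, List.sum_cons, List.sum_nil, Int.cast_one, PConeFedderData.monomial_five]
  ring

/-- ★ **THE FEDDER WITNESS AT `P`**: `g₂₇₇ ∈ 𝔪_P^{[2]} = (Y₀², Y₁², (Y₂+1)², Y₃², Y₄²)` — in characteristic 2, `Y₂² + 1 = (Y₂+1)²`, and every other term of `g₂₇₇` is a
multiple of the square of a variable vanishing at `P`. [certificate reading; cite: Fedder1983, Thm. 1.12] -/
theorem evalL_G277_mem_frobeniusPower_P [CharP k 2] :
    KLocCellKit.evalL k (G (277 : Fin 327)) ∈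
      Ideal.span ({X 0 ^ 2, X 1 ^ 2, (X 2 + 1) ^ 2, X 3 ^ 2, X 4 ^ 2} : Set (MvPolynomial (Fin 5) k)) := by
  have h2 : (2 : MvPolynomial (Fin 5) k) = 0 := (FermatCubicConeChar2.two_three k (n := 5)).1
  have hg : KLocCellKit.evalL k (G (277 : Fin 327)) =
      (X 2 + 1) ^ 2 * 1 + X 4 ^ 2 * (X 2 * X 3 * X 4 ^ 2) + X 1 ^ 2 * X 1 + X 0 ^ 2 * X 0 + X 3 ^ 2 * (X 2 * X 4) := by
    have h : (X 2 + 1) ^ 2 * 1 + X 4 ^ 2 * (X 2 * X 3 * X 4 ^ 2) + X 1 ^ 2 * X 1 + X 0 ^ 2 * X 0 + X 3 ^ 2 * (X 2 * X 4) =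
        KLocCellKit.evalL k (G (277 : Fin 327)) + 2 * X 2 := by
      rw [evalL_G277]; ring
    rw [h, h2, zero_mul, add_zero]
  rw [hg]
  have hmem : ∀ q ∈ ({X 0 ^ 2, X 1 ^ 2, (X 2 + 1) ^ 2, X 3 ^ 2, X 4 ^ 2} : Set (MvPolynomial (Fin 5) k)), ∀ r : MvPolynomial (Fin 5) k,
      q * r ∈ Ideal.span ({X 0 ^ 2, X 1 ^ 2, (X 2 + 1) ^ 2, X 3 ^ 2, X 4 ^ 2} : Set (MvPolynomial (Fin 5) k)) :=
    fun q hq r => Ideal.mul_mem_right _ _ (Ideal.subset_span hq)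
  refine Ideal.add_mem _ (Ideal.add_mem _ (Ideal.add_mem _ (Ideal.add_mem _ (hmem _ (by simp) _) (hmem _ (by simp) _)) (hmem _ (by simp) _))
    (hmem _ (by simp) _)) (hmem _ (by simp) _)

/-- `𝔪_P^{[2]} ≤ 𝔪_P`, so in particular both lie under the maximal ideal `𝔪_P = (Y₀, Y₁, Y₂+1, Y₃, Y₄)` (the span of the avoid generators). [folklore] -/
theorem frobeniusPower_P_le_span_HS [CharP k 2] :
    Ideal.span ({X 0 ^ 2, X 1 ^ 2, (X 2 + 1) ^ 2, X 3 ^ 2, X 4 ^ 2} : Set (MvPolynomial (Fin 5) k)) ≤ Ideal.span {x | x ∈ HS.map (KLocCellKit.evalL k)} := by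
  rw [HS_map_evalL, Ideal.span_le]
  have hsub : ∀ q : MvPolynomial (Fin 5) k, q ∈ [X 0, X 1, X 2 + 1, X 3, X 4] → q ^ 2 ∈ Ideal.span {x | x ∈ [X 0, X 1, X 2 + 1, X 3, X 4]} :=
    fun q hq => by rw [pow_two]; exact Ideal.mul_mem_left _ _ (Ideal.subset_span hq)
  rintro _ (rfl | rfl | rfl | rfl | rfl)
  · exact hsub _ (by simp)
  · exact hsub _ (by simp)
  · exact hsub _ (by simp)
  · exact hsub _ (by simp)
  · exact hsub _ (by simp)

end Summit.ResolutionOfSingularities.ResolutionOfSingularities.Theorems.FInjectiveMacaulayfication.FDStorey1PFedder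

end
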